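import Summits.BirchSwinnertonDyer.BirchSwinnertonDyer.Theorems.AdditiveKolyvaginRoadLenderDatumOfZhang
import Literature.NumberTheory.EllipticCurves.WZhang2014.LevelRaisedBipartiteSystem
import HarnessLib

/-!
# Route `AdditiveKolyvaginRoad`, crux KS′ `LevelKolyvaginSystemsAdditive` (item stmt-BirchSwinnertonDyer-21396), line
# `epsilon_matched_retyping`, skeleton v7 (sha16 29721a78c90211f5): registered stub S5a′ `stub_lenderDatumOfZhangFact` — THE DICTIONARY
# from W. Zhang's printed level-raised bipartite system (Literature named fact `WZhang2014.exists_levelRaisedBipartiteSystem`, p612492)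
# to the carrier's datum `(ε₀, κ₀, lam)` of the lender `E₀` (cell `pub/bsd-wall`, width seat `bsd-wall-akr-p2x-w2` g4;
# `--supports stmt-BirchSwinnertonDyer-21396`; namespace `…Theorems.AdditiveKoly`)

WHY. Skeleton v7 of the line reshaped S5a (K1(E₀) in print) into S5a′: the same nine-row conclusion, with Zhang's bipartite system as the
HYPOTHESIS `hZ : WZhang2014.exists_levelRaisedBipartiteSystem` (one refereed named fact over the data structure
`WZhang2014.LevelRaisedBipartiteData W₀ K p` and its nine predicates). What is left is E-side bookkeeping, done here: instantiate `hZ` at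
`(W₀, p, K, Dt₀, β₀, ι, c)` (Hypothesis ♠ (2) as `Or.inr htwo₀`), and translate — levels `Finset (AdmQ W₀ K p) ↦ Finset ℕ` by
`Finset.image Subtype.val` (admissible, same cardinality ∕ parity), conductors `Finset {ℓ // Zhang2014.IsKolyvaginPrime …} ↦ ℕ` by `∏ ℓ ∈ m, ℓ`
(a square-free product of Zhang–Kolyvagin primes, `KolyvaginDescent.KolSupp`, prime-factor count `#m`, `insert ↔ · * ℓ`), signs `ℤ ↦ Bool`
(`ε₀ n := decide (sign = 1)`, and `sgnP (ε₀ ^^ bodd k) = sign · (−1)^k` for `sign = ±1`), the toric ∕ transverse rows by definitional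
unfolding (`toricLocalKer` = `valuedLocalKer` at the augmentation subgroup; `mem_transverseLocalKerP_iff`).

WHAT. §1 two more index lemmas (`LenderDatum.isKolyvaginConductor_prod_val`, `LenderDatum.sgnP_decide_xor_bodd`). §2 the registered stub
**`stub_lenderDatumOfZhangFact`**, signature VERBATIM from the tree skeleton (`Cruxes/LevelKolyvaginSystemsAdditive/Lines/epsilon_matched_retyping.lean`,
v7); its hypotheses `hodd`, `hsplit` and the `Module (ZMod p)` instance are part of the registered signature and idle in the proof.

HONEST FRAMING: theorems only; 0 definitions, 0 new named facts, 0 `sorry`. The stub is CONDITIONAL by design on the displayed Literature fact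
`WZhang2014.exists_levelRaisedBipartiteSystem` (W. Zhang 2014 Thm. 2.1 ∕ §3 ∕ Lemma 3.3 ∕ Thm. 4.3 ∕ Thm. 5.2 ∕ §8.1 with Bertolini–Darmon 2005
Thms. 4.1–4.2 and Gross 1991 Prop. 5.4; statement-only, no `_holds`), taken as the hypothesis `hZ` exactly as registered. Closes nothing by
itself; BSD is not proved by any of this; KS′ is not proved.

References: [cite: WZhang2014, Notations (xii), (xiv); §3.7 (3.21)–(3.22); §3.9 (3.30); Thm. 4.3 (4.3)–(4.5); Thm. 5.2; §8.1]
[cite: BertoliniDarmon2005, §2.2–§2.3, Thm. 4.1, Thm. 4.2] [cite: GrossLMS1991, §3–§4, Prop. 5.4] [cite: McCallumLMS1991, Prop. 4.4].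
-/

set_option linter.dupNamespace false -- single-conjunct summit repeats the name by design
set_option autoImplicit false

noncomputable section

open scoped Classical

namespace Summit.BirchSwinnertonDyer.BirchSwinnertonDyer.Theorems.AdditiveKoly

open WeierstrassCurve NumberField IsDedekindDomain Field
  Literature.NumberTheory.EllipticCurves Literature.NumberTheory.EllipticCurves.ModularForms
  Literature.NumberTheory.EllipticCurves.Rank1Residual Literature.NumberTheory.GaloisRepresentations
  Literature.NumberTheory.GaloisCohomology
  Summit.BirchSwinnertonDyer.Rank1Residual

/-! ## §1 Two more index lemmas -/

namespace LenderDatum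

section Index

variable (W₀ : WeierstrassCurve ℚ) [W₀.IsGloballyMinimal] (K : Type) [Field K] [NumberField K] (p : ℕ) [Fact p.Prime]

omit [Fact p.Prime] in
/-- **Products of distinct Zhang–Kolyvagin primes are Kolyvagin conductors `n ∈ Λ`** in the sense of W. Zhang's Notations (xii)
(square-free, every prime factor a Zhang–Kolyvagin prime; the Literature predicate `WZhang2014.IsKolyvaginConductor`).
[cite: WZhang2014, Notations (xii)] -/
theorem isKolyvaginConductor_prod_val (m : Finset {ℓ // Zhang2014.IsKolyvaginPrime (W₀.conductorNorm ℤ) W₀ K p ℓ}) :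
    WZhang2014.IsKolyvaginConductor (W := W₀) (K := K) (p := p) (∏ ℓ ∈ m, (ℓ : ℕ)) := by
  refine ⟨?_, fun ℓ hℓ ↦ ?_⟩
  · refine Finset.squarefree_prod_of_pairwise_isCoprime ?_ (fun ℓ _ ↦ ℓ.2.1.squarefree)
    intro x _ y _ hxy
    have hne : (x : ℕ) ≠ y := fun h ↦ hxy (Subtype.val_injective h)
    exact Nat.coprime_iff_isRelPrime.mp ((Nat.coprime_primes x.2.1 y.2.1).mpr hne)
  · rw [primeFactors_prod_val] at hℓ
    obtain ⟨ℓ', -, rfl⟩ := Finset.mem_image.mp hℓ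
    exact ℓ'.2

end Index

/-- **Sign dictionary**: for a sign `s = ±1` recorded as the Boolean `decide (s = 1)`, the carrier's sign `sgnP (· ^^ bodd k)` is
`s · (−1)^k`. [folklore] -/
theorem sgnP_decide_xor_bodd {s : ℤ} (hs : s = 1 ∨ s = -1) (k : ℕ) :
    sgnP (decide (s = 1) ^^ Nat.bodd k) = s * (-1) ^ k := by
  induction k with
  | zero =>
    rcases hs with rfl | rfl
    · simp [sgnP]
    · simp [sgnP]
  | succ k ih =>
    rw [Nat.bodd_succ, Bool.xor_not, pow_succ, ← mul_assoc, ← ih]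
    cases (decide (s = 1) ^^ Nat.bodd k) <;> simp [sgnP]

end LenderDatum

/-! ## §2 The registered stub S5a′ -/

set_option linter.unusedVariables false in
/-- **Stub S5a′ `stub_lenderDatumOfZhangFact` of line `epsilon_matched_retyping` (skeleton v7), VERBATIM: THE DICTIONARY — K1(E₀) FROM
ZHANG'S PRINTED BIPARTITE SYSTEM, BY NAME.** For a `p`-good ordinary `E₀ = W₀` (`p ≥ 5`, `ρ̄_{E₀,p}` onto, Hypothesis ♠ (1)(2)), an imaginary
quadratic Heegner field `K` for `N₀` with `d_K` odd `< −4`, `p` split and `p ∤ d_K`, an orientation `β₀`, a parametrisation `Dt₀` and a complex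
conjugation `c ≠ 1`, ASSUMING the Literature named fact `hZ : WZhang2014.exists_levelRaisedBipartiteSystem` (W. Zhang 2014 §§3–4 ∕ §8.1 with
Bertolini–Darmon 2005 and Gross 1991): there are level signs `ε₀`, classes `κ₀(m, n) ∈ H¹(K, E₀[p])` and odd-level values `λ(m, n)` with the
nine rows — realisation at level `∅` by Kolyvagin–Heegner data, sign, E₀'s Kummer condition off `m ∪ n` and at infinity, toric on `n`,
transverse on `m`, the relation (8.1), and the two reciprocity laws two-sided. PROOF: instantiate `hZ` at `(W₀, p, K, Dt₀, β₀, ι, c)` and set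
`ε₀ n := decide (sign (n.image val) = 1)`, `κ₀ m n := c((n.image val), ∏ ℓ ∈ m, ℓ)`, `lam m n := λ((n.image val), ∏ ℓ ∈ m, ℓ)`; the rows are
the fact's predicates read through the index dictionary of `AdditiveKolyvaginRoadLenderDatumOfZhang` (`hodd`, `hsplit` idle).
[cite: WZhang2014, §3.7 (3.21)–(3.22), §3.9 (3.30), Thm. 4.3 (4.3)–(4.5), Thm. 5.2, §8.1 property (1) and (8.1)]
[cite: BertoliniDarmon2005, §2.2–§2.3, Thm. 4.1, Thm. 4.2] [cite: GrossLMS1991, §3–§4, Prop. 5.4] [cite: McCallumLMS1991, Prop. 4.4] -/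
theorem stub_lenderDatumOfZhangFact (W₀ : WeierstrassCurve ℚ) [W₀.IsElliptic] [W₀.IsGloballyMinimal]
    [NeZero (W₀.conductorNorm ℤ)] (p : ℕ) [Fact p.Prime] (K : Type) [Field K] [NumberField K]
    (Dt₀ : ModularParametrizationData W₀ (W₀.conductorNorm ℤ)) (β₀ : ℤ) (ι : K →+* ℂ) (hp : 5 ≤ p)
    (hord : IsOrdinaryAt W₀ p) (hs₀ : W₀.HasSurjectiveModNGaloisRep p)
    (hsp₀ : ∀ (ℓ : ℕ) [Fact ℓ.Prime], W₀.HasMultiplicativeReductionAtPrime ℓ →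
      ¬ p ∣ padicValInt ℓ W₀.minimalDiscriminantInt)
    (htwo₀ : ∃ (ℓ₁ ℓ₂ : ℕ) (_ : Fact ℓ₁.Prime) (_ : Fact ℓ₂.Prime), ℓ₁ ≠ ℓ₂ ∧
      W₀.HasMultiplicativeReductionAtPrime ℓ₁ ∧ W₀.HasMultiplicativeReductionAtPrime ℓ₂)
    (hK : IsImaginaryQuadratic K) (hodd : Odd (NumberField.discr K)) (hlt : NumberField.discr K < -4)
    (hsplit : ((Ideal.span {(p : ℤ)}).primesOver (𝓞 K)).ncard = 2)
    (hH₀ : SatisfiesHeegnerHypothesis (W₀.conductorNorm ℤ) K)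
    (hβ₀ : (4 * (W₀.conductorNorm ℤ : ℤ)) ∣ β₀ ^ 2 - NumberField.discr K) (c : K ≃ₐ[ℚ] K) (hc1 : c ≠ 1)
    (hpd : ¬ ((p : ℤ) ∣ NumberField.discr K)) (hZ : WZhang2014.exists_levelRaisedBipartiteSystem)
    [Module (ZMod p) (Vp W₀ K p)] :
    ∃ (ε₀ : Finset (AdmQ W₀ K p) → Bool)
      (κ₀ : Finset {ℓ // Zhang2014.IsKolyvaginPrime (W₀.conductorNorm ℤ) W₀ K p ℓ} → Finset (AdmQ W₀ K p) → Vp W₀ K p)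
      (lam : Finset {ℓ // Zhang2014.IsKolyvaginPrime (W₀.conductorNorm ℤ) W₀ K p ℓ} → Finset (AdmQ W₀ K p) → ZMod p),
      -- realisation at level `∅`
      (∀ m : Finset {ℓ // Zhang2014.IsKolyvaginPrime (W₀.conductorNorm ℤ) W₀ K p ℓ},
        ∃ d : KolyvaginHeegnerData Dt₀ β₀ ι (∏ ℓ ∈ m, (ℓ : ℕ)), κ₀ m ∅ = d.kolyvaginClass (Fact.out : p.Prime) 1) ∧
      -- sign
      (∀ n : Finset (AdmQ W₀ K p), n.Nonempty → Even n.card →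
        ∀ m : Finset {ℓ // Zhang2014.IsKolyvaginPrime (W₀.conductorNorm ℤ) W₀ K p ℓ},
        conjAct W₀ c ((p ^ 1 : ℕ) : ℤ) (κ₀ m n) = sgnP (ε₀ n ^^ Nat.bodd m.card) • κ₀ m n) ∧
      -- selmer_off
      (∀ n : Finset (AdmQ W₀ K p), n.Nonempty → Even n.card →
        ∀ (m : Finset {ℓ // Zhang2014.IsKolyvaginPrime (W₀.conductorNorm ℤ) W₀ K p ℓ}) (v : HeightOneSpectrum (𝓞 K)),
        (∀ ℓ ∈ m, ((ℓ : ℕ) : 𝓞 K) ∉ v.asIdeal) → (∀ q ∈ n, ((q : ℕ) : 𝓞 K) ∉ v.asIdeal) →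
        κ₀ m n ∈ selmerLocalKer (W₀.baseChange K) (v.adicCompletion K) ((p ^ 1 : ℕ) : ℤ)) ∧
      -- selmer_inf
      (∀ n : Finset (AdmQ W₀ K p), n.Nonempty → Even n.card →
        ∀ (m : Finset {ℓ // Zhang2014.IsKolyvaginPrime (W₀.conductorNorm ℤ) W₀ K p ℓ}) (w : InfinitePlace K),
        κ₀ m n ∈ selmerLocalKer (W₀.baseChange K) w.Completion ((p ^ 1 : ℕ) : ℤ)) ∧
      -- toric_on
      (∀ n : Finset (AdmQ W₀ K p), n.Nonempty → Even n.card →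
        ∀ m : Finset {ℓ // Zhang2014.IsKolyvaginPrime (W₀.conductorNorm ℤ) W₀ K p ℓ}, ∀ q ∈ n,
        ∀ v : HeightOneSpectrum (𝓞 K), ((q : ℕ) : 𝓞 K) ∈ v.asIdeal →
        κ₀ m n ∈ toricLocalKer (W₀.baseChange K) (v.adicCompletion K) ((p ^ 1 : ℕ) : ℤ)) ∧
      -- transverse_on
      (∀ n : Finset (AdmQ W₀ K p), n.Nonempty → Even n.card →
        ∀ m : Finset {ℓ // Zhang2014.IsKolyvaginPrime (W₀.conductorNorm ℤ) W₀ K p ℓ}, ∀ ℓ ∈ m,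
        ∀ v : HeightOneSpectrum (𝓞 K), ((ℓ : ℕ) : 𝓞 K) ∈ v.asIdeal → κ₀ m n ∈ transverseLocalKerP W₀ K p ι ℓ v) ∧
      -- relation (8.1)
      (∀ n : Finset (AdmQ W₀ K p), n.Nonempty → Even n.card →
        ∀ (m : Finset {ℓ // Zhang2014.IsKolyvaginPrime (W₀.conductorNorm ℤ) W₀ K p ℓ})
          (ℓ : {ℓ // Zhang2014.IsKolyvaginPrime (W₀.conductorNorm ℤ) W₀ K p ℓ}), ℓ ∉ m →
        ∀ v : HeightOneSpectrum (𝓞 K), ((ℓ : ℕ) : 𝓞 K) ∈ v.asIdeal →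
        (κ₀ (insert ℓ m) n ∈ (W₀.baseChange K).torsionLocalKer (v.adicCompletion K) ((p ^ 1 : ℕ) : ℤ) ↔
          κ₀ m n ∈ (W₀.baseChange K).torsionLocalKer (v.adicCompletion K) ((p ^ 1 : ℕ) : ℤ))) ∧
      -- law (A), two-sided (Zhang Thm. 4.3, first identity; BD05 Thm. 4.2)
      (∀ (n : Finset (AdmQ W₀ K p)) (q : AdmQ W₀ K p), Even n.card → q ∉ n →
        ∀ m : Finset {ℓ // Zhang2014.IsKolyvaginPrime (W₀.conductorNorm ℤ) W₀ K p ℓ},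
        lam m (insert q n) ≠ 0 ↔ ∃ v : HeightOneSpectrum (𝓞 K), ((q : ℕ) : 𝓞 K) ∈ v.asIdeal ∧
          κ₀ m n ∉ (W₀.baseChange K).torsionLocalKer (v.adicCompletion K) ((p ^ 1 : ℕ) : ℤ)) ∧
      -- law (B), two-sided (Zhang Thm. 4.3, second identity; BD05 Thm. 4.1)
      (∀ (n : Finset (AdmQ W₀ K p)) (q : AdmQ W₀ K p), Odd n.card → q ∉ n →
        ∀ m : Finset {ℓ // Zhang2014.IsKolyvaginPrime (W₀.conductorNorm ℤ) W₀ K p ℓ},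
        (∃ v : HeightOneSpectrum (𝓞 K), ((q : ℕ) : 𝓞 K) ∈ v.asIdeal ∧
          κ₀ m (insert q n) ∉ (W₀.baseChange K).torsionLocalKer (v.adicCompletion K) ((p ^ 1 : ℕ) : ℤ)) ↔
          lam m n ≠ 0) := by
  -- Zhang's printed bipartite system for the lender, instantiated at `(W₀, p, K, Dt₀, β₀, ι, c)` (♠(2) as `Or.inr htwo₀`)
  obtain ⟨d, hsgn, hreal, hS, hoff, hinf, htor, htr, hrel, hA, hB⟩ :=
    hZ W₀ p K Dt₀ β₀ ι c hp hord hs₀ hsp₀ (Or.inr htwo₀) hK hlt hpd hH₀ hβ₀ hc1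
  -- the index dictionary
  have hadm : ∀ n : Finset (AdmQ W₀ K p),
      IsZhangAdmissibleLevel (W₀.conductorNorm ℤ) K (fun ℓ ↦ W₀.frobeniusTrace ℓ) p (n.image Subtype.val) :=
    LenderDatum.image_val_isZhangAdmissibleLevel W₀ K p
  have hkol : ∀ m : Finset {ℓ // Zhang2014.IsKolyvaginPrime (W₀.conductorNorm ℤ) W₀ K p ℓ},
      WZhang2014.IsKolyvaginConductor (W := W₀) (K := K) (p := p) (∏ ℓ ∈ m, (ℓ : ℕ)) :=
    LenderDatum.isKolyvaginConductor_prod_val W₀ K p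
  have hev : ∀ n : Finset (AdmQ W₀ K p), Even n.card →
      WZhang2014.IsEvenLevel (W := W₀) (K := K) (p := p) (n.image Subtype.val) :=
    fun n hn ↦ ⟨hadm n, by rwa [LenderDatum.card_image_val]⟩
  have hod : ∀ n : Finset (AdmQ W₀ K p), Odd n.card →
      WZhang2014.IsOddLevel (W := W₀) (K := K) (p := p) (n.image Subtype.val) :=
    fun n hn ↦ ⟨hadm n, by rwa [LenderDatum.card_image_val]⟩
  have hevi : ∀ (n : Finset (AdmQ W₀ K p)) (q : AdmQ W₀ K p), Odd n.card → q ∉ n →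
      WZhang2014.IsEvenLevel (W := W₀) (K := K) (p := p) (insert q.1 (n.image Subtype.val)) := by
    intro n q hn hq
    refine ⟨by rw [← LenderDatum.image_val_insert]; exact hadm (insert q n), ?_⟩
    rw [Finset.card_insert_of_notMem (LenderDatum.val_notMem_image hq), LenderDatum.card_image_val]
    exact hn.add_one
  have hodi : ∀ (n : Finset (AdmQ W₀ K p)) (q : AdmQ W₀ K p), Even n.card → q ∉ n →
      WZhang2014.IsOddLevel (W := W₀) (K := K) (p := p) (insert q.1 (n.image Subtype.val)) := by
    intro n q hn hq
    refine ⟨by rw [← LenderDatum.image_val_insert]; exact hadm (insert q n), ?_⟩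
    rw [Finset.card_insert_of_notMem (LenderDatum.val_notMem_image hq), LenderDatum.card_image_val]
    exact hn.add_one
  refine ⟨fun n ↦ decide (d.sign (n.image Subtype.val) = 1),
    fun m n ↦ d.kolyvaginClass (n.image Subtype.val) (∏ ℓ ∈ m, (ℓ : ℕ)),
    fun m n ↦ d.value (n.image Subtype.val) (∏ ℓ ∈ m, (ℓ : ℕ)), ?_, ?_, ?_, ?_, ?_, ?_, ?_, ?_, ?_⟩
  · -- realisation at level `∅`
    intro m
    simpa only [Finset.image_empty] using hreal _ (hkol m)
  · -- sign
    intro n hn hev' m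
    have h := hS _ (hev n hev') _ (hkol m)
    rw [LenderDatum.card_primeFactors_prod_val, ← LenderDatum.sgnP_decide_xor_bodd (hsgn _)] at h
    exact h
  · -- selmer_off
    intro n hn hev' m v hm hq
    refine hoff _ (hev n hev') _ (hkol m) v (fun q hq' ↦ ?_) (fun ℓ hℓ ↦ ?_)
    · obtain ⟨q', hq'', rfl⟩ := Finset.mem_image.mp hq'
      exact hq q' hq''
    · rw [LenderDatum.primeFactors_prod_val] at hℓ
      obtain ⟨ℓ', hℓ', rfl⟩ := Finset.mem_image.mp hℓ
      exact hm ℓ' hℓ'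
  · -- selmer_inf
    intro n hn hev' m w
    exact hinf _ (hev n hev') _ (hkol m) w
  · -- toric_on (`toricLocalKer` is `valuedLocalKer` at the augmentation subgroup, definitionally)
    intro n hn hev' m q hq v hv
    exact htor _ (hev n hev') _ (hkol m) q.1 (Finset.mem_image_of_mem _ hq) v hv
  · -- transverse_on (`mem_transverseLocalKerP_iff` is `Iff.rfl`)
    intro n hn hev' m ℓ hℓ v hv
    refine mem_transverseLocalKerP_iff.mpr (htr _ (hev n hev') _ (hkol m) ℓ.1 ?_ v hv)
    rw [LenderDatum.primeFactors_prod_val]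
    exact Finset.mem_image_of_mem _ hℓ
  · -- relation (8.1)
    intro n hn hev' m ℓ hℓ v hv
    beta_reduce
    rw [LenderDatum.prod_val_insert W₀ K p hℓ]
    refine hrel _ (hev n hev') _ ℓ.1 ?_ ℓ.2.1 (LenderDatum.not_dvd_prod_val W₀ K p hℓ) v hv
    rw [← LenderDatum.prod_val_insert W₀ K p hℓ]
    exact hkol (insert ℓ m)
  · -- law (A)
    intro n q hev' hq m
    have h := hA (n.image Subtype.val) (hev n hev') q.1 (LenderDatum.val_notMem_image hq) (hodi n q hev' hq) _ (hkol m)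
    rwa [← LenderDatum.image_val_insert] at h
  · -- law (B)
    intro n q hodd' hq m
    have h := hB (n.image Subtype.val) (hod n hodd') q.1 (LenderDatum.val_notMem_image hq) (hevi n q hodd' hq) _ (hkol m)
    rwa [← LenderDatum.image_val_insert] at h

/-! ## §3 The dictionary at the level of the datum (fact-agnostic form) -/

/-- **The dictionary, fact-agnostic form.** GIVEN a level-raised bipartite datum `d : WZhang2014.LevelRaisedBipartiteData W₀ K p` of the
lender with signs `±1` satisfying the nine Literature predicates (realisation on `(Dt₀, β₀, ι)`, sign eigen-property for `c`, Kummer off ∕ at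
infinity, toric, transverse, relation (8.1), first and second reciprocity laws) — i.e. exactly the ∃-BODY of
`WZhang2014.exists_levelRaisedBipartiteSystem` — the carrier's datum `(ε₀, κ₀, lam)` with its nine rows exists (same translation as in
`stub_lenderDatumOfZhangFact`, whose proof is `obtain ⟨d, …⟩ := hZ …` followed by this argument). Use: any restatement of the named fact with
other standing hypotheses (e.g. `p` good instead of good ordinary) plugs into the line's composition through this theorem unchanged.
[cite: WZhang2014, §3.7 (3.21)–(3.22), Thm. 4.3 (4.3)–(4.5), Thm. 5.2, §8.1] [cite: BertoliniDarmon2005, Thm. 4.1, Thm. 4.2]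
[cite: GrossLMS1991, Prop. 5.4] -/
theorem LenderDatum.lenderDatum_of_levelRaisedBipartiteData (W₀ : WeierstrassCurve ℚ) [W₀.IsElliptic] [W₀.IsGloballyMinimal]
    [NeZero (W₀.conductorNorm ℤ)] (p : ℕ) [Fact p.Prime] (K : Type) [Field K] [NumberField K]
    (Dt₀ : ModularParametrizationData W₀ (W₀.conductorNorm ℤ)) (β₀ : ℤ) (ι : K →+* ℂ) (c : K ≃ₐ[ℚ] K)
    (d : WZhang2014.LevelRaisedBipartiteData W₀ K p) (hsgn : ∀ m, d.sign m = 1 ∨ d.sign m = -1)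
    (hreal : d.IsRealisation Dt₀ β₀ ι) (hS : d.IsSignEigen c) (hoff : d.SatisfiesKummerOff) (hinf : d.SatisfiesKummerInf)
    (htor : d.SatisfiesToricOn) (htr : d.SatisfiesTransverseOn ι) (hrel : d.SatisfiesRelation) (hA : d.SatisfiesFirstLaw)
    (hB : d.SatisfiesSecondLaw) :
    ∃ (ε₀ : Finset (AdmQ W₀ K p) → Bool)
      (κ₀ : Finset {ℓ // Zhang2014.IsKolyvaginPrime (W₀.conductorNorm ℤ) W₀ K p ℓ} → Finset (AdmQ W₀ K p) → Vp W₀ K p)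
      (lam : Finset {ℓ // Zhang2014.IsKolyvaginPrime (W₀.conductorNorm ℤ) W₀ K p ℓ} → Finset (AdmQ W₀ K p) → ZMod p),
      -- realisation at level `∅`
      (∀ m : Finset {ℓ // Zhang2014.IsKolyvaginPrime (W₀.conductorNorm ℤ) W₀ K p ℓ},
        ∃ d : KolyvaginHeegnerData Dt₀ β₀ ι (∏ ℓ ∈ m, (ℓ : ℕ)), κ₀ m ∅ = d.kolyvaginClass (Fact.out : p.Prime) 1) ∧
      -- sign
      (∀ n : Finset (AdmQ W₀ K p), n.Nonempty → Even n.card →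
        ∀ m : Finset {ℓ // Zhang2014.IsKolyvaginPrime (W₀.conductorNorm ℤ) W₀ K p ℓ},
        conjAct W₀ c ((p ^ 1 : ℕ) : ℤ) (κ₀ m n) = sgnP (ε₀ n ^^ Nat.bodd m.card) • κ₀ m n) ∧
      -- selmer_off
      (∀ n : Finset (AdmQ W₀ K p), n.Nonempty → Even n.card →
        ∀ (m : Finset {ℓ // Zhang2014.IsKolyvaginPrime (W₀.conductorNorm ℤ) W₀ K p ℓ}) (v : HeightOneSpectrum (𝓞 K)),
        (∀ ℓ ∈ m, ((ℓ : ℕ) : 𝓞 K) ∉ v.asIdeal) → (∀ q ∈ n, ((q : ℕ) : 𝓞 K) ∉ v.asIdeal) →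
        κ₀ m n ∈ selmerLocalKer (W₀.baseChange K) (v.adicCompletion K) ((p ^ 1 : ℕ) : ℤ)) ∧
      -- selmer_inf
      (∀ n : Finset (AdmQ W₀ K p), n.Nonempty → Even n.card →
        ∀ (m : Finset {ℓ // Zhang2014.IsKolyvaginPrime (W₀.conductorNorm ℤ) W₀ K p ℓ}) (w : InfinitePlace K),
        κ₀ m n ∈ selmerLocalKer (W₀.baseChange K) w.Completion ((p ^ 1 : ℕ) : ℤ)) ∧
      -- toric_on
      (∀ n : Finset (AdmQ W₀ K p), n.Nonempty → Even n.card →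
        ∀ m : Finset {ℓ // Zhang2014.IsKolyvaginPrime (W₀.conductorNorm ℤ) W₀ K p ℓ}, ∀ q ∈ n,
        ∀ v : HeightOneSpectrum (𝓞 K), ((q : ℕ) : 𝓞 K) ∈ v.asIdeal →
        κ₀ m n ∈ toricLocalKer (W₀.baseChange K) (v.adicCompletion K) ((p ^ 1 : ℕ) : ℤ)) ∧
      -- transverse_on
      (∀ n : Finset (AdmQ W₀ K p), n.Nonempty → Even n.card →
        ∀ m : Finset {ℓ // Zhang2014.IsKolyvaginPrime (W₀.conductorNorm ℤ) W₀ K p ℓ}, ∀ ℓ ∈ m,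
        ∀ v : HeightOneSpectrum (𝓞 K), ((ℓ : ℕ) : 𝓞 K) ∈ v.asIdeal → κ₀ m n ∈ transverseLocalKerP W₀ K p ι ℓ v) ∧
      -- relation (8.1)
      (∀ n : Finset (AdmQ W₀ K p), n.Nonempty → Even n.card →
        ∀ (m : Finset {ℓ // Zhang2014.IsKolyvaginPrime (W₀.conductorNorm ℤ) W₀ K p ℓ})
          (ℓ : {ℓ // Zhang2014.IsKolyvaginPrime (W₀.conductorNorm ℤ) W₀ K p ℓ}), ℓ ∉ m →
        ∀ v : HeightOneSpectrum (𝓞 K), ((ℓ : ℕ) : 𝓞 K) ∈ v.asIdeal →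
        (κ₀ (insert ℓ m) n ∈ (W₀.baseChange K).torsionLocalKer (v.adicCompletion K) ((p ^ 1 : ℕ) : ℤ) ↔
          κ₀ m n ∈ (W₀.baseChange K).torsionLocalKer (v.adicCompletion K) ((p ^ 1 : ℕ) : ℤ))) ∧
      -- law (A), two-sided (Zhang Thm. 4.3, first identity; BD05 Thm. 4.2)
      (∀ (n : Finset (AdmQ W₀ K p)) (q : AdmQ W₀ K p), Even n.card → q ∉ n →
        ∀ m : Finset {ℓ // Zhang2014.IsKolyvaginPrime (W₀.conductorNorm ℤ) W₀ K p ℓ},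
        lam m (insert q n) ≠ 0 ↔ ∃ v : HeightOneSpectrum (𝓞 K), ((q : ℕ) : 𝓞 K) ∈ v.asIdeal ∧
          κ₀ m n ∉ (W₀.baseChange K).torsionLocalKer (v.adicCompletion K) ((p ^ 1 : ℕ) : ℤ)) ∧
      -- law (B), two-sided (Zhang Thm. 4.3, second identity; BD05 Thm. 4.1)
      (∀ (n : Finset (AdmQ W₀ K p)) (q : AdmQ W₀ K p), Odd n.card → q ∉ n →
        ∀ m : Finset {ℓ // Zhang2014.IsKolyvaginPrime (W₀.conductorNorm ℤ) W₀ K p ℓ},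
        (∃ v : HeightOneSpectrum (𝓞 K), ((q : ℕ) : 𝓞 K) ∈ v.asIdeal ∧
          κ₀ m (insert q n) ∉ (W₀.baseChange K).torsionLocalKer (v.adicCompletion K) ((p ^ 1 : ℕ) : ℤ)) ↔
          lam m n ≠ 0) := by
  -- the index dictionary
  have hadm : ∀ n : Finset (AdmQ W₀ K p),
      IsZhangAdmissibleLevel (W₀.conductorNorm ℤ) K (fun ℓ ↦ W₀.frobeniusTrace ℓ) p (n.image Subtype.val) :=
    LenderDatum.image_val_isZhangAdmissibleLevel W₀ K p
  have hkol : ∀ m : Finset {ℓ // Zhang2014.IsKolyvaginPrime (W₀.conductorNorm ℤ) W₀ K p ℓ},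
      WZhang2014.IsKolyvaginConductor (W := W₀) (K := K) (p := p) (∏ ℓ ∈ m, (ℓ : ℕ)) :=
    LenderDatum.isKolyvaginConductor_prod_val W₀ K p
  have hev : ∀ n : Finset (AdmQ W₀ K p), Even n.card →
      WZhang2014.IsEvenLevel (W := W₀) (K := K) (p := p) (n.image Subtype.val) :=
    fun n hn ↦ ⟨hadm n, by rwa [LenderDatum.card_image_val]⟩
  have hod : ∀ n : Finset (AdmQ W₀ K p), Odd n.card →
      WZhang2014.IsOddLevel (W := W₀) (K := K) (p := p) (n.image Subtype.val) :=
    fun n hn ↦ ⟨hadm n, by rwa [LenderDatum.card_image_val]⟩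
  have hevi : ∀ (n : Finset (AdmQ W₀ K p)) (q : AdmQ W₀ K p), Odd n.card → q ∉ n →
      WZhang2014.IsEvenLevel (W := W₀) (K := K) (p := p) (insert q.1 (n.image Subtype.val)) := by
    intro n q hn hq
    refine ⟨by rw [← LenderDatum.image_val_insert]; exact hadm (insert q n), ?_⟩
    rw [Finset.card_insert_of_notMem (LenderDatum.val_notMem_image hq), LenderDatum.card_image_val]
    exact hn.add_one
  have hodi : ∀ (n : Finset (AdmQ W₀ K p)) (q : AdmQ W₀ K p), Even n.card → q ∉ n →
      WZhang2014.IsOddLevel (W := W₀) (K := K) (p := p) (insert q.1 (n.image Subtype.val)) := by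
    intro n q hn hq
    refine ⟨by rw [← LenderDatum.image_val_insert]; exact hadm (insert q n), ?_⟩
    rw [Finset.card_insert_of_notMem (LenderDatum.val_notMem_image hq), LenderDatum.card_image_val]
    exact hn.add_one
  refine ⟨fun n ↦ decide (d.sign (n.image Subtype.val) = 1),
    fun m n ↦ d.kolyvaginClass (n.image Subtype.val) (∏ ℓ ∈ m, (ℓ : ℕ)),
    fun m n ↦ d.value (n.image Subtype.val) (∏ ℓ ∈ m, (ℓ : ℕ)), ?_, ?_, ?_, ?_, ?_, ?_, ?_, ?_, ?_⟩
  · -- realisation at level `∅`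
    intro m
    simpa only [Finset.image_empty] using hreal _ (hkol m)
  · -- sign
    intro n hn hev' m
    have h := hS _ (hev n hev') _ (hkol m)
    rw [LenderDatum.card_primeFactors_prod_val, ← LenderDatum.sgnP_decide_xor_bodd (hsgn _)] at h
    exact h
  · -- selmer_off
    intro n hn hev' m v hm hq
    refine hoff _ (hev n hev') _ (hkol m) v (fun q hq' ↦ ?_) (fun ℓ hℓ ↦ ?_)
    · obtain ⟨q', hq'', rfl⟩ := Finset.mem_image.mp hq'
      exact hq q' hq''
    · rw [LenderDatum.primeFactors_prod_val] at hℓ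
      obtain ⟨ℓ', hℓ', rfl⟩ := Finset.mem_image.mp hℓ
      exact hm ℓ' hℓ'
  · -- selmer_inf
    intro n hn hev' m w
    exact hinf _ (hev n hev') _ (hkol m) w
  · -- toric_on (`toricLocalKer` is `valuedLocalKer` at the augmentation subgroup, definitionally)
    intro n hn hev' m q hq v hv
    exact htor _ (hev n hev') _ (hkol m) q.1 (Finset.mem_image_of_mem _ hq) v hv
  · -- transverse_on (`mem_transverseLocalKerP_iff` is `Iff.rfl`)
    intro n hn hev' m ℓ hℓ v hv
    refine mem_transverseLocalKerP_iff.mpr (htr _ (hev n hev') _ (hkol m) ℓ.1 ?_ v hv)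
    rw [LenderDatum.primeFactors_prod_val]
    exact Finset.mem_image_of_mem _ hℓ
  · -- relation (8.1)
    intro n hn hev' m ℓ hℓ v hv
    beta_reduce
    rw [LenderDatum.prod_val_insert W₀ K p hℓ]
    refine hrel _ (hev n hev') _ ℓ.1 ?_ ℓ.2.1 (LenderDatum.not_dvd_prod_val W₀ K p hℓ) v hv
    rw [← LenderDatum.prod_val_insert W₀ K p hℓ]
    exact hkol (insert ℓ m)
  · -- law (A)
    intro n q hev' hq m
    have h := hA (n.image Subtype.val) (hev n hev') q.1 (LenderDatum.val_notMem_image hq) (hodi n q hev' hq) _ (hkol m)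
    rwa [← LenderDatum.image_val_insert] at h
  · -- law (B)
    intro n q hodd' hq m
    have h := hB (n.image Subtype.val) (hod n hodd') q.1 (LenderDatum.val_notMem_image hq) (hevi n q hodd' hq) _ (hkol m)
    rwa [← LenderDatum.image_val_insert] at h

end Summit.BirchSwinnertonDyer.BirchSwinnertonDyer.Theorems.AdditiveKoly

end
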